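import Mathlib
import HarnessLib
import HarnessLib.Audit
import Summits.ValiantsHypothesis.Statement
import Literature.Computability.AlgebraicComplexity.ValiantConjectureProofs
import HarnessLib.Audit.Status.Attr

/-!
Route: NewtonUnitEquations

CLOSED (refuted) 2026-08-20T21:25:10Z by gate — reason: refuted:stmt-ValiantsHypothesis-19542 (None) by Summit.ValiantsHypothesis.ValiantsHypothesis.Theorems.NewtonUnitEquationsNewtonTauWeak.not_hbigDesigns — note: repair grace of 72.0 h (deadline 2026-08-20T20:50:09Z) expired without a repair — closed by the gate. The file is kept as the record of this route; refuted decls are indexed as negative knowledge (`ledger negatives`).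

# Route NewtonUnitEquations — KPTT's Newton-polygon tau-conjecture (ROOT form) through the
unit-equation (tensor-rank) structure of cancellation sets

It suffices to show X = NewtonTauRoot (retarget 2026-08-17, rev 2–3; ranking §2.9 / strategist r1),
the Koiran–Portier–Tavenas–
Thomassé τ-conjecture for Newton polygons weakened to the TRANSFER THRESHOLD of KPTT Thm 1
(arXiv:1308.2286; printed remark
"upper bounds of the form 2^(O(m))(kt)^(O(1)), or even 2^((m+log kt)^c) for some c < 2, are
enough"): there are constants a, b
such that for every bivariate f = Σ_(i<k) Π_(j<m) f_ij over ℂ with every f_ij having at most t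
monomials, the Newton polygon of
f has at most 2^(a·m)·(k·t+2)^(b·(⌊√m⌋+1)) vertices (exponent c = 3/2 < 2). The former deciding
statement NewtonTauWeak
(exponent b, KPTT's own weak form) stays in the route as the SHARP FORM: NewtonTauWeak →
NewtonTauRoot with the same constants,
so every line on the sharp form (the kernel chain binomialNewtonTauCommon → commonStep →
binomialStep → fischerStep, three of
four steps landed) closes the root form verbatim, while the root form's √m slack admits lines the
sharp form does not
(log-depth halving / shadow recursions with exponent O(log m) ≤ O(√m), collision-tolerant digit
frames with exponent
O(log #levels)). KPTT Thm 1 re-run at the root threshold (support item KpttTransferRoot, X inlined;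
proved sorry-free in
Cruxes/NewtonTauWeak/StrategistGen2Retarget.lean, candidate Theorems file attached to the item)
turns X into "the permanent is
not a VP family over ℂ, constants unrestricted", and Valiant's theorem per ∈ VNP_ℂ with the
VP-renaming bridge gives VP_ℂ ≠ VNP_ℂ.
The route realises card newton-polygon-unit-equations: a point of the potential support disappears
only through a VANISHING SUM
of coefficient products (a unit equation); in the dissociated regime this is a statement about
supports of rank-k tensors
(DissociatedUniform, DissociatedFixedK proved, BinomialPencil proved); the two-product coincidence
case (TwoProducts) is KPTT §5.
Lean: `∃ a b : ℕ, ∀ (k m t : ℕ) (f : Fin k → Fin m → MvPolynomial (Fin 2) ℂ), (∀ i j, (f i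
j).support.card ≤ t) → (Set.extremePoints ℝ (convexHull ℝ ((fun e : Fin 2 →₀ ℕ => fun i : Fin 2 =>
((e i : ℕ) : ℝ)) '' ((∑ i, ∏ j, f i j).support : Set (Fin 2 →₀ ℕ))))).ncard ≤ 2 ^ (a * m) * (k * t +
2) ^ (b * (Nat.sqrt m + 1))`

## Assembly
Deciding theorem `closes (h₁ : NewtonTauRoot) (h₂ : KpttTransferRoot) : ValiantsHypothesis` (rev 3,
certified native, axioms
propext/Classical.choice/Quot.sound): h₂ h₁ : ¬IsVPFamily (perPoly · ℂ); if VP ℂ = VNP ℂ then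
perFamily ℂ ∈ VNP ℂ
(Literature.Computability.AlgebraicComplexity.perFamily_mem_VNP_holds ℂ) lies in VP ℂ and the proved
bridge
Literature.Computability.AlgebraicComplexity.mem_VP_ofFintype_iff_holds makes (per_n) a VP family —
contradiction. The legacy
Assembly item (NewtonTauWeak → KpttTransfer → ValiantsHypothesis, proved) remains true and now
factors through
NewtonTauWeak → NewtonTauRoot. Ranked steps toward X: the kernel chain's open head
binomialNewtonTauCommon (lead line on
NewtonTauWeak, feeds X through the sharp form), DissociatedUniform (dissociated supports, all k; its
ROOT-budget version is
PROVED: rung NewtonTauRoot_dissociated, a = 0, b = 14, attached to the crux item) and TwoProducts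
(all supports, k = 2).

Rationale: WHY THIS LINE. RETARGET (2026-08-17, rev 2–3, ranking §2.9 / strategist r1 D-J): the deciding
statement is now the ROOT form NewtonTauRoot — the same vertex count with the budget
2^(a·m)(kt+2)^(b(⌊√m⌋+1)), the weakest polynomial-shape bound that still transfers (KPTT slide/paper
remark "2^((m+log kt)^c), c < 2, is enough"; here c = 3/2); closes := NewtonTauRoot →
KpttTransferRoot → ValiantsHypothesis (certified native). Why easier, with named tools: the root
exponent may grow like √m, so (i) any LOG-DEPTH HALVING recursion on m (Theorem-Q-type shadow bound
|⋃_λ Vert(Σλ_iP_i)| ≤ 4^(q−1)(mt)^(q−1), landed p101934; vert(gh) ≤ 2·σ₂ with exponent doubling per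
halving, O(log m) halvings) lands inside the budget where the sharp form allows O(1) doublings only;
(ii) collision-tolerant DIGIT/CARRY frames are already in: k-uniform (k(rc+1)+2)^(38⌈log₂(n+2)⌉) for
n-level expand-frames (Theorem B, p128954) and the dissociated quasi bound (kt+2)^(14⌈log₂(m+2)⌉)
(p87014) are theorems, and ⌈log₂(m+2)⌉ ≤ ⌊√m⌋+2 puts both inside NewtonTauRoot (rung
NewtonTauRoot_dissociated, a = 0, b = 14, sorry-free, attached) while they are NOT inside
NewtonTauWeak; (iii) nothing is lost: NewtonTauWeak → NewtonTauRoot (same constants), so the kernel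
chain closes the root form verbatim. ORIGINAL LINE. KPTT (arXiv:1308.2286 §2) name cancellation as
"the main difficulty" and treat it only through convex geometry of Minkowski
sums (Thms 5–6: O(k·t^(2m/3)) via Eisenbrand–Pach–Rothvoß–Sopher; Prop 1: that engine cannot beat
t^(m/3); sharpened by
Skomra–Thomassé arXiv:1903.11287), never through the algebra of WHICH sums vanish. This line
structures cancellation on the
coefficient side: on the refined support grid A_1 × ⋯ × A_m the coefficient function is a tensor of
rank ≤ k, a cancelled
point is a zero of that tensor (a k-term unit equation in the coefficients), and when the grid is
dissociated (unique sums)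
the w-extreme surviving point is reached from the w-top of the grid by re-choosing at most k−1
coordinates — a Fischer/Ryser-type
rank fact: c·y_1⋯y_s is not a sum of ≤ s products of univariate affine forms — which yields
poly(m,t) vertices for each fixed k
(DissociatedFixedK; k=2, t=2 is the card's cube-independence lemma, BinomialPencil) where convexity
alone is stuck at t^(2m/3).
Imported areas: unit equations / vanishing sums (EvertseGyory2015; the COUNTING theorems
exp((6n)^(3n)(r+1)) are conceded to
be useless here, r ≤ kmt — only the structural reading is used), tensor rank and
fooling-set/flattening lower bounds
(algebraic complexity's own toolkit turned on the conjecture), threshold/zonotope combinatorics.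
What prior routes do not do:
TauConst (integer/real zeros, constant-elimination gap) lists "τ-conjecture for Newton polygons" as
not decomposed; no route or
negative touches KPTT Conj 1; the sibling cards newton-polygon-freiman (additive structure of
exponents) and ultrametric-sps-tau
(local Newton–Puiseux over ℂ((s))) are silent exactly in the dissociated common-support regime
(maximal cross-product
coincidence, zero additive structure), which this route owns.

RANKED CRUXES. #0 NewtonTauRoot (crux, DECIDING; stmt-ValiantsHypothesis-18547) — root form of the
weak Newton-polygon τ-conjecture: vertices of Newt(Σ_(i<k) Π_(j<m) f_ij) ≤ 2^(a·m)(kt+2)^(b(⌊√m⌋+1))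
for t-sparse bivariate f_ij over ℂ. Registered birth line `kernel-chain`
(bc/NewtonTauRoot_birth.lean, attached): stub_binomialNewtonTauCommon (OPEN, hardest) →
stub_commonStep → stub_binomialStep → stub_fischerStep (landed) → NewtonTauWeak (12b, 4b) →
NewtonTauRoot, composition NewtonTauRoot_of kernel-checked; root-specific lines (halving/shadow
recursion with collisions; carry-automaton frames) are for the crux-ideate seats of this item. (why
it might fail: it is still a uniform bound for ALL depth-4 expressions with arbitrary complex
cancellations: a designed cancellation on KPTT Example-3 digit grids (t^(m/3) convexly independent
candidates) with k, t = poly(m) refutes root and sharp form at once; Hrubeš–Yehudayoff: σ(DS_n) ≥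
2^(n^(3/4+ε)) for the doubly-stochastic/determinant shadow would refute the root form (their Open
Problem; the τ-conjecture forces σ(DS_n) ≤ 2^(O(√n log² n))).) [arXiv:1308.2286,
KoiranPortierTavenasThomasse2015, HrubesYehudayoff2021, arXiv:1903.11287]
#9 KpttTransferRoot (support; stmt-ValiantsHypothesis-18548) — KPTT Thm 1 re-run at the root
threshold: NewtonTauRoot (inlined) → ¬IsVPFamily (perPoly · ℂ). PROVED sorry-free as
KPTT.kpttTransferRoot_holds in Cruxes/NewtonTauWeak/StrategistGen2Retarget.lean (admissible-bound
transfer not_isVPFamily_per_of_admissible + exists_rootBound_lt_two_pow: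
2^(aC√n)((n+2)^(2C√n)+2)^(b(⌊√(C√n)⌋+1)) < 2^n eventually); a by-name candidate Theorems file
(KpttTransferRoot_candidate.lean, rc 0 on the local copy) is attached to the item — a prover lands
it verbatim. [arXiv:1308.2286, Tavenas2014]
#0′ NewtonTauWeak (crux; SHARP FORM, implies NewtonTauRoot with the same constants; deciding crux of
the sibling route NewtonFrames; lead line binomial-normal-form: stubs commonStep p90067 /
binomialStep p86119 / fischerStep p85961 LANDED, open head stub_binomialNewtonTauCommon = KPTT Conj
1 for Σ_l c_l Π_j (1 − ρ_lj X^(d_j)), poly(K,N)) — KPTT's sufficient weak form of the Newton-polygon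
τ-conjecture: vertices of Newt(Σ_(i<k) Π_(j<m) f_ij) ≤ 2^(a·m)(kt+2)^b for t-sparse bivariate f_ij
over ℂ (vertices = extreme points of the convex hull of the support in ℝ²). (why it might fail:
Example-3 digit grids carry t^(m/3) convexly independent candidates inside the potential support; k
~ t^(m/3) products realise them (consistent), but a cleverer cancellation design with k, t = poly(m)
would refute X and KPTT Conj 1 at once — no evidence either way beyond fg+1 ≤ O(t^(4/3)).)
[arXiv:1308.2286, KoiranPortierTavenasThomasse2015, arXiv:1903.11287, HrubesYehudayoff2021]
#2 DissociatedUniform (crux) — k-UNIFORM polynomial bound in the dissociated regime (card crux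
"k-uniform bound"): if supp f_ij ⊆ A_j with |A_j| ≤ t and the sum map A_1 × ⋯ × A_m → ℕ² is
injective (every point of the potential support has a unique exponent tuple), then Newt(Σ_i Π_j
f_ij) has ≤ (kmt+2)^C vertices. Equivalently: the planar image of the support of a rank-≤k tensor in
⊗_j ℂ^(A_j) has poly(k,m,t) hull vertices. [difficulty: open-problem] (why it might fail: rank-k
tensors over roots of unity have huge designed zero sets (survivors {|S| ≡ r mod q} need only k =
q); a design whose zero set swallows all points outside a long convex chain of a dissociated digit
grid (KPTT Ex. 3 grids ARE dissociated) gives superpoly(kmt) vertices, refuting KPTT Conj 1.)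
[arXiv:1308.2286, EvertseGyory2015, doi:10.1090/s0894-0347-01-00367-8, arXiv:1903.11287]
#3 TwoProducts (crux) — two products with arbitrary (coinciding) exponents: Newt(Π_(j<m) f_j −
Π_(j<m) g_j) has ≤ 2^(a·m)(t+2)^b vertices for t-sparse f_j, g_j (X at k = 2; contains KPTT §5 open
problems: fg+1 (m = 2, known O(t^(4/3)), conjectured linear) and f_1⋯f_m + 1, and the card's R2 with
binomial f_j). Here a cancelled point is a vanishing sum over a whole FIBRE of the sum map,
Σ_(a∈fibre) (Πc(a) − Πc'(a)) = 0. [difficulty: L] (why it might fail: coincidences make each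
coefficient a long vanishing sum (±1 / roots of unity: pure counting of representations), KPTT
Example 3's digit grids hold t^(m/3) convexly independent candidates and two cleverly signed
products might carve them; even fg+1 is open between t and t^(4/3) (KPTT §5).) [arXiv:1308.2286,
KoiranPortierTavenasThomasse2015, arXiv:1903.11287]
#4 DissociatedFixedK (crux, PROVED) — fixed-k polynomial bound (mt+2)^C(k) in the dissociated regime
(stratified thickness + cube lemma). [arXiv:1308.2286, Fischer1975, EvertseGyory2015]
#9 BinomialPencil (support, PROVED) — the card's (2,2) rung, O(m²) vertices for a two-term pencil of
binomial products with distinct subset sums. [arXiv:1308.2286, Fischer1975]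
#9 KpttTransfer (support, PROVED) — KPTT Thm 1 for the sharp form (NewtonTauWeak → ¬IsVPFamily per),
Literature KPTT.theorem1_holds; superseded in closes by KpttTransferRoot but kept (the legacy
Assembly is proved through it). [arXiv:1308.2286, KoiranPortierTavenasThomasse2015, Tavenas2014,
Koiran2011]

TWO-LAYER PLAN. Nothing filed (D-0019). The one decomposition in play lives at line level on the
sharp form: NewtonTauWeak ⇐ stub_binomialNewtonTauCommon → commonStep → binomialStep → fischerStep
(three landed), re-registered for NewtonTauRoot as birth line kernel-chain. Foreseen for the root
crux only if its ideate seats ask: a glued split NewtonTauRoot ⇐ CollisionHalving (shadow-union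
bound with a poly loss factor under exponent collisions) → RootFromHalving (the O(log m)-depth
recursion bookkeeping, routine).

KILL CRITERIA. A family refuting NewtonTauRoot (vertices beyond 2^(O(m))·(kt)^(O(√m)), e.g. a
designed cancellation on KPTT Example-3 digit grids, or σ(DS_n) ≥ 2^(n^(3/4+ε)) à la
Hrubeš–Yehudayoff) closes the route `refuted:NewtonTauRoot` and kills every Newton-polygon τ line at
once (hand the witness to NewtonFrames and the sibling cards). A refutation of NewtonTauWeak ALONE
(sharp constants false, root budget intact) does NOT close the route: drop the sharp form, keep
closes as is, and re-point the kernel-chain seats at root-budget lines. DissociatedUniform refuted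
with vertices still inside the root budget: restate it in root shape (its root-shape version is
already the proved rung). TwoProducts refuted ⇒ X false at k = 2 only if the witness beats the ROOT
budget (m-uniform families with 2^(ω(m)) vertices at t = O(1)); else restate. Mooted if another
route proves ¬IsVPFamily per or VH outright.

NOT DECOMPOSED YET. ROOT-SPECIFIC LINES (deliberately not filed as items — D-0019 two layers; they
are LINES on crux #0 for its ideate/plan seats): (a) collision-tolerant shadow halving — extend
Theorem Q (dissociated: |⋃_λ Vert| ≤ 4^(q−1)(mt)^(q−1)) to colliding supports with a loss factor per
halving that the √m exponent absorbs; (b) carry-automaton universality — which frames embed into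
bounded-carry digit frames (Theorem B regime); (c) the strategist census D-J records why the √m
slack cannot be spent INSIDE the kernel chain (the binomial normal form erases m: N = m·t).
PREVIOUSLY RECORDED. The general-k COINCIDENCE regime (non-injective sum map), which is where KPTT's
Thm-1 parameters actually live (k, t = n^(O(√n)),
m = O(√n): t^m exponent tuples are forced into 2^(O(n)) lattice points, so fibre sums are long) — it
needs either a structure
theorem for vanishing fibre sums (Laurent-type: identically cancelling sub-products on cosets +
sporadic solutions) or the
additive-combinatorial engine of the sibling card; filing it now would be a third layer. Also not
filed: explicit constants
(the 4^k(mt+1)^k form of DissociatedFixedK), the torsion-regime design question as a separate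
negative item (refuters may file
¬DissociatedUniform), the t-dependence refinements of BinomialPencil (binomials → t-nomials with
common supports: single-coordinate
escape, O(m²t⁴)), and a Literature cite fact for KPTT Thm 1 (KpttTransfer is provable in-tree from
TavenasVnWitness machinery).

CHEAPEST FALSIFIER. Exhaustive/hill-climbing search in the dissociated subset-sum cube (t = 2,
common exponents, coefficients roots of unity of order
≤ 12 or small integers, k ≤ 8, m ≤ 14): count hull vertices of the survivors; superlinear-in-k or
superquadratic-in-m growth
kills DissociatedUniform's spirit immediately. I ran the script locally at smoke-test size (kit
compute socket absent on this
hub at filing; script kept at folder kit/newton_dissoc_probe.py for a refuter's kit job): max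
vertices found 14, 20, 24(26), 28
for m = 6, 8, 10, 12 — ≈ 2m + O(1), flat in k ∈ {2,…,8} and across residue-class designs {|S| ≡ r
mod q}, q ≤ 7; nothing near m².
Second cheapest: KPTT Example 3 digit grid with b = 2, m = 6..9 — search two signed products
(TwoProducts) for > 4m vertices. For the root form specifically: the same searches, but a kill now
needs growth faster than (kt)^(c√m) — in practice any superpolynomial-in-(kmt) vertex growth at
bounded t found by search kills sharp and root form together.

NUMBERS. Trivial bound k·t^m; no-cancellation bound kmt (KPTT §2); convexity engine O(k·t^(2m/3))
(KPTT Thm 6) and its floor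
M_m(t) ≥ t^(m/3) − 1 (KPTT Prop 1); fg+1: O(t^(4/3)) (KPTT Thm 5), linear under same-support
hypotheses (KPTT App. Thm 7);
ci(P+Q) = Θ(n log n) for convex n-gons (Skomra–Thomassé arXiv:1903.11287 Thm 1.1, Tiwary 2014).
Transfer regime (KPTT §3 /
Tavenas2014 Prop 3.21 as in the tree): k, t ≤ (n+2)^(C(√d+1)), m ≤ C(√d+1), d = O(n), against 2^n
vertices. Unit-equation
counts (for the record, unused): non-degenerate solutions of a_1x_1+⋯+a_nx_n = 1 in a rank-r group ≤
exp((6n)^(3n)(r+1))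
(Evertse–Schlickewei–Schmidt 2002; EvertseGyory2015 Ch. 6). This route's proved-on-paper rungs:
BinomialPencil O(m²);
k = 2 common t-supports O(m²t⁴); DissociatedFixedK 4^k(mt+1)^k. Items at open: 7 (1 target, 3
cruxes, 2 support, 1 assembly). Root-form bookkeeping: NewtonTauWeak (a,b) ⇒ NewtonTauRoot (a,b);
kernel chain T2 exponent b ⇒ root constants (12b, 4b); dissociated rung a = 0, b = 14 via
⌈log₂(m+2)⌉ ≤ ⌊√m⌋+2; transfer: X = a·E + (2E+2)·b(⌊√E⌋+1) log-exponent with E = C√n stays O(n^(3/4)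
log n) < n. Items after retarget: 12 (cruxes NewtonTauRoot #0, NewtonTauWeak, DissociatedUniform #2,
TwoProducts #3, DissociatedFixedK #4 proved; supports LogFactorBound, FewProductsBound,
KpttTransferLog proved, KpttTransferRoot, BinomialPencil proved, KpttTransfer proved; Assembly
proved); cone of closes = {NewtonTauRoot, KpttTransferRoot}.

DEFINITION REQUESTS. None required: the vertex count is inlined as `(Set.extremePoints ℝ (convexHull
ℝ (image of p.support in Fin 2 → ℝ))).ncard`
(Mathlib), and IsVPFamily / perPoly exist (Literature.Computability.AlgebraicComplexity). Optional
later: a Literature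
abbreviation `newtonVertexCount` if several Newton-polygon routes open (the sibling card asked for
`newtonPolygonVertices`), and a
cite fact for KPTT Thm 1 (bib key KoiranPortierTavenasThomasse2015 added this session).

Novelty: Searches (2026-08-15): `lit citing arxiv:1308.2286` (10 local-graph citers: BriquelBurgisser2020,
real-τ SOS 2021, lonely
runners 2020, Yehudayoff 2019 monotone VP/VNP, weak-space 2017, Σ∧Σ∧Σ 2017, tropical Nullstellensatz
2017, log-concavity
MFCS 2015 arXiv:1503.07705, Tavenas2014 — none structures cancellation sets multiplicatively or via
tensor rank);
`lit search --source zbmath` for "tau-conjecture Newton polygons sparse polynomials" (1: KPTT),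
"convexly independent subsets
Minkowski sum" (3: EPRS 2008, Bílka et al. 2010, Skomra–Thomassé 2021), "Newton polytope support low
rank tensor" (1, irrelevant:
Breiding–Kohn–Sturmfels 2024), "zero patterns polynomials Rónyai Babai Ganapathy" (RBG 2001 + 2
incidence papers),
"vanishing sums sparse polynomials products support cancellation" (0), "Newton polygon difference of
two products sparse" (0),
"number of vertices Newton polygon lacunary polynomial" (0); `lit search --source crossref` same
first query (only unrelated
Newton-polygon papers); `lit galaxy search --star all` for "tau-conjecture for Newton polygons" (1:
FoCM'17 abstracts book),
"Newton polygon of fg+1" (0), "convexly independent subsets of the Minkowski sum" (Skomra–Thomassé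
HAL ×2, GD 2015 volume),
"sums of products of sparse polynomials" (MFCS 2015 volume only); arXiv/OpenAlex/S2 APIs
rate-limited (429) at search time;
the card's own audit (refuter-novelty-audit-4) had already read KPTT and HrubesYehudayoff2021 in
full.
Nearest prior art found: arXiv:1308.2286 = K  [refs: 10.1090/s0894-0347-01-00367-8, 1308.2286, 1503.07705, 1903.11287, arxiv:1308.2286, doi:10.1090/s0894-0347-01-00367-8, BriquelBurgisser2020, Tavenas2014, HrubesYehudayoff2021, KoiranPortierTavenasThomasse2015, EvertseGyory2015]

Barriers (technique_class: unit-equations, tensor-rank-thickness, newton-polygon-tau): - technique_class: unit-equations, tensor-rank-thickness, newton-polygon-tau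
- Literature.Barriers.ValiantsHypothesis.TauRealZeros: does not apply — no real or integer zeros are
counted; the complexity measure is the vertex count of the Newton polygon of a sum of products of
sparse polynomials, and the transfer (KPTT Thm 1) goes through depth-4 reduction exactly as the
catalogued evasion for the real τ-conjecture (restrict the CIRCUITS to ΣΠ-sparse form), with
constants free.
- Literature.Barriers.ValiantsHypothesis.MonotoneGap: does not apply — nothing is inferred from
monotone complexity; the no-cancellation (e.g. positive-coefficient) case is the trivial kmt bound
(KPTT §2) and every crux is about cancellations with arbitrary complex coefficients.
- Literature.Barriers.ValiantsHypothesis.AlgebraicNaturalProofs: does not apply in form — the hard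
witness Σ X^i Y^(2i(2^n−1−i)) is certified hard by a SUPPORT-PATTERN property (many hull vertices),
a constructible but not Zariski-closed condition on coefficient vectors (generic dense polynomials
have 4 vertices), so no distinguisher polynomial vanishing on VP is produced; the bet is that
support geometry of depth-4 expressions is rigid enough, which the (conditional) barrier does not
address.
- Literature.Barriers.ValiantsHypothesis.DepthReductionChasm: used, not fought — the route needs
only the proved n^(O(√n)) depth-4 reduction (upper bound direction) inside KpttTransfer; the lower
bound is on vertex counts, not on a VP-satur

History (route lifecycle, newest last):
- 2026-08-16T02:18:10Z · AUTO-CRUX: 1 conjecture-grade item(s) promoted to crux (NewtonTauWeak) — refuter vetting / tiering apply (operator:999:1362873)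
- 2026-08-16T04:21:15Z · AUTO-CRUX (backfill): NewtonTauWeak — hypotheses of the deciding theorem that nothing in the route derives are cruxes (operator:999:1085951)
- 2026-08-17T20:50:09Z · BROKEN — stmt-ValiantsHypothesis-19542 (stmt-ValiantsHypothesis-19542, support) refuted by Summit.ValiantsHypothesis.ValiantsHypothesis.Theorems.NewtonUnitEquationsNewtonTauWeak.not_hbigDesigns @ 6dc8d4642fac (prover-rtask-ValiantsHypothesis-NewtonUnitE-71e67d26-0)
- 2026-08-20T21:25:11Z · CLOSED refuted — refuted:stmt-ValiantsHypothesis-19542 (None) by Summit.ValiantsHypothesis.ValiantsHypothesis.Theorems.NewtonUnitEquationsNewtonTauWeak.not_hbigDesigns (grace expired, auto-close) (gate)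

sub-problem: ValiantsHypothesis · status: closed(refuted) · opened planner-plancard-ValiantsHypothesis-ValiantsH-6c7c4eb3-0 2026-08-15T11:43:26Z · rev 4 · ledger route-ValiantsHypothesis-NewtonUnitEquations
GENERATED by the gate from the ledger (D-0016/17). Provers cite these decls: `theorem foo : Summit.ValiantsHypothesis.ValiantsHypothesis.Theses.NewtonUnitEquations.<Decl> := …` in Summits/ValiantsHypothesis/ValiantsHypothesis/Theorems/<Name>.lean.
-/

namespace Summit.ValiantsHypothesis.ValiantsHypothesis.Theses.NewtonUnitEquations

open scoped BigOperators Topology Manifold Classical MeasureTheory ProbabilityTheory Matrix InnerProductSpace ComplexConjugate ContinuousMap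
open Filter Set Function TopologicalSpace MeasureTheory

attribute [summit_statement] _root_.ValiantsHypothesis

open Literature.PNP

/-- item stmt-ValiantsHypothesis-18547 · crux · rank 0 · closed · moot by None · by planner
why it might fail: False iff for all a,b some sum of k products of m t-sparse bivariate polynomials has > 2^(am)(kt+2)^(b(√m+1)) Newton vertices: a cancellation design across products (fibre sums on colliding frames) with k,t = poly(m) and 2^ω(m) vertices kills it and KPTT Conj 1; only the dissociated regime is known.
sources: arXiv:1308.2286, KoiranPortierTavenasThomasse2015, arXiv:1903.11287, HrubesYehudayoff2021
[crux, DECIDING after retarget] KPTT's weak Newton-polygon τ-conjecture in ROOT form: the Newton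
polygon of Σ_(i<k) Π_(j<m) f_ij, f_ij t-sparse bivariate over ℂ, has ≤ 2^(a·m)·(kt+2)^(b(⌊√m⌋+1))
vertices for some absolute a, b. Implied by NewtonTauWeak (same a, b:
newtonTauRoot_of_newtonTauWeak); genuinely weaker (the kt-exponent may grow like √m, not
padding-reachable from the sharp form: STRATEGY-CENSUS.md S-J (v)); still transfers to PER ∉ VP_ℂ
(KpttTransferRoot) because on the reduced permanent (k,m,t) = ((n+2)^{C√n}, C√n, (n+2)^{C√n}) the
bound is (n+2)^{O(n^{3/4})}·2^{O(√n)} < 2^n. The landed k-uniform dissociated Theorem Q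
((t+2)(8(k+2)^3)^⌈log₂ m⌉, Theorems/NewtonUnitEquationsDissociatedUniformQuasiPoly) and
stub_dissociatedQuasiShape ((kt+2)^{7⌈log₂(m+2)⌉}) lie INSIDE this envelope: progress for Root, only
evidence for Weak. -/
@[route_item "route-ValiantsHypothesis-NewtonUnitEquations", crux]
def NewtonTauRoot : Prop :=
  ∃ a b : ℕ, ∀ (k m t : ℕ) (f : Fin k → Fin m → MvPolynomial (Fin 2) ℂ), (∀ i j, (f i j).support.card ≤ t) → (Set.extremePoints ℝ (convexHull ℝ ((fun e : Fin 2 →₀ ℕ => fun i : Fin 2 => ((e i : ℕ) : ℝ)) '' ((∑ i, ∏ j, f i j).support : Set (Fin 2 →₀ ℕ))))).ncard ≤ 2 ^ (a * m) * (k * t + 2) ^ (b * (Nat.sqrt m + 1))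

/-- item stmt-ValiantsHypothesis-5904 · crux (kind.auto-crux: conjecture-grade) · rank 0 · open · by planner
why it might fail: Example-3 digit grids carry t^(m/3) convexly independent candidates inside the potential support; k ~ t^(m/3) products realise them (consistent), but a cleverer cancellation design with k, t = poly(m) would refute X and KPTT Conj 1 at once — no evidence either way beyond fg+1 ≤ O(t^(4/3)).
sources: arXiv:1308.2286, KoiranPortierTavenasThomasse2015, arXiv:1903.11287, HrubesYehudayoff2021
[target] KPTT's sufficient weak form of the Newton-polygon τ-conjecture: vertices of Newt(Σ_(i<k)
Π_(j<m) f_ij) ≤ 2^(a·m)(kt+2)^b for t-sparse bivariate f_ij over ℂ (vertices = extreme points of the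
convex hull of the support in ℝ²). -/
@[route_item "route-ValiantsHypothesis-NewtonUnitEquations", crux]
def NewtonTauWeak : Prop :=
  ∃ a b : ℕ, ∀ (k m t : ℕ) (f : Fin k → Fin m → MvPolynomial (Fin 2) ℂ), (∀ i j, (f i j).support.card ≤ t) → (Set.extremePoints ℝ (convexHull ℝ ((fun e : Fin 2 →₀ ℕ => fun i : Fin 2 => ((e i : ℕ) : ℝ)) '' ((∑ i, ∏ j, f i j).support : Set (Fin 2 →₀ ℕ))))).ncard ≤ 2 ^ (a * m) * (k * t + 2) ^ b

/-- item stmt-ValiantsHypothesis-5905 · crux · rank 2 · open · by planner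
why it might fail: rank-k tensors over roots of unity have huge designed zero sets (survivors {|S| ≡ r mod q} need only k = q); a design whose zero set swallows all points outside a long convex chain of a dissociated digit grid (KPTT Ex. 3 grids ARE dissociated) gives superpoly(kmt) vertices, refuting KPTT Conj 1.
sources: arXiv:1308.2286, EvertseGyory2015, doi:10.1090/s0894-0347-01-00367-8, arXiv:1903.11287
[crux] k-UNIFORM polynomial bound in the dissociated regime (card crux "k-uniform bound"): if supp
f_ij ⊆ A_j with |A_j| ≤ t and the sum map A_1 × ⋯ × A_m → ℕ² is injective (every point of the
potential support has a unique exponent tuple), then Newt(Σ_i Π_j f_ij) has ≤ (kmt+2)^C vertices.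
Equivalently: the planar image of the support of a rank-≤k tensor in ⊗_j ℂ^(A_j) has poly(k,m,t)
hull vertices. [difficulty: open-problem] -/
@[route_item "route-ValiantsHypothesis-NewtonUnitEquations"]
def DissociatedUniform : Prop :=
  ∃ C : ℕ, ∀ (k m t : ℕ) (A : Fin m → Finset (Fin 2 →₀ ℕ)) (f : Fin k → Fin m → MvPolynomial (Fin 2) ℂ), (∀ j, (A j).card ≤ t) → (∀ i j, (f i j).support ⊆ A j) → (∀ a b : Fin m → (Fin 2 →₀ ℕ), (∀ j, a j ∈ A j) → (∀ j, b j ∈ A j) → ∑ j, a j = ∑ j, b j → a = b) → (Set.extremePoints ℝ (convexHull ℝ ((fun e : Fin 2 →₀ ℕ => fun i : Fin 2 => ((e i : ℕ) : ℝ)) '' ((∑ i, ∏ j, f i j).support : Set (Fin 2 →₀ ℕ))))).ncard ≤ (k * m * t + 2) ^ C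

/-- item stmt-ValiantsHypothesis-5906 · crux · rank 3 · open · by planner
why it might fail: coincidences make each coefficient a long vanishing sum (±1 / roots of unity: pure counting of representations), KPTT Example 3's digit grids hold t^(m/3) convexly independent candidates and two cleverly signed products might carve them; even fg+1 is open between t and t^(4/3) (KPTT §5).
sources: arXiv:1308.2286, KoiranPortierTavenasThomasse2015, arXiv:1903.11287
[crux] two products with arbitrary (coinciding) exponents: Newt(Π_(j<m) f_j − Π_(j<m) g_j) has ≤
2^(a·m)(t+2)^b vertices for t-sparse f_j, g_j (X at k = 2; contains KPTT §5 open problems: fg+1 (m =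
2, known O(t^(4/3)), conjectured linear) and f_1⋯f_m + 1, and the card's R2 with binomial f_j). Here
a cancelled point is a vanishing sum over a whole FIBRE of the sum map, Σ_(a∈fibre) (Πc(a) − Πc'(a))
= 0. [difficulty: L] -/
@[route_item "route-ValiantsHypothesis-NewtonUnitEquations"]
def TwoProducts : Prop :=
  ∃ a b : ℕ, ∀ (m t : ℕ) (f g : Fin m → MvPolynomial (Fin 2) ℂ), (∀ j, (f j).support.card ≤ t) → (∀ j, (g j).support.card ≤ t) → (Set.extremePoints ℝ (convexHull ℝ ((fun e : Fin 2 →₀ ℕ => fun i : Fin 2 => ((e i : ℕ) : ℝ)) '' ((∏ j, f j - ∏ j, g j).support : Set (Fin 2 →₀ ℕ))))).ncard ≤ 2 ^ (a * m) * (t + 2) ^ b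

/-- item stmt-ValiantsHypothesis-5907 · crux · rank 4 · closed · proved by Summit.ValiantsHypothesis.Theorems.dissociatedFixedK_proof (prover) · by planner
why it might fail: the sketch is the planner's and unrefereed: products dead at the top and identically cancelling pairs break the naive 'thickness ≤ k−1' (hence the stratification); the generic-direction reduction (each hull vertex is the unique w-top on an open arc avoiding ties) and the cell count need care.
sources: arXiv:1308.2286, Fischer1975, EvertseGyory2015
[crux] fixed-k polynomial bound in the dissociated regime (card crux "thickness lemma for fixed k",
made precise): for every k there is C with vertices ≤ (mt+2)^C under the hypotheses of
DissociatedUniform. Sketch (planner, NOTES.md): stratify the grid by the alive pattern I(a) = {i : a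
∈ Π_j supp f_ij}; for a generic direction w the w-top survivor of each stratum differs from the
stratum's box-top in ≤ k−1 coordinates (cube lemma: c·y_1⋯y_s = Σ_(i≤k) x_i Π_j (1+u_ij y_j), c ≠ 0
⇒ k ≥ s+1, by induction substituting y_s = −1/u); candidates per ordering cell ≤ 2^k(mt+1)^(k−1),
cells ≤ 2^k·mt, so vertices ≤ 4^k (mt+1)^k. [difficulty: M] -/
@[route_item "route-ValiantsHypothesis-NewtonUnitEquations"]
def DissociatedFixedK : Prop :=
  ∀ k : ℕ, ∃ C : ℕ, ∀ (m t : ℕ) (A : Fin m → Finset (Fin 2 →₀ ℕ)) (f : Fin k → Fin m → MvPolynomial (Fin 2) ℂ), (∀ j, (A j).card ≤ t) → (∀ i j, (f i j).support ⊆ A j) → (∀ a b : Fin m → (Fin 2 →₀ ℕ), (∀ j, a j ∈ A j) → (∀ j, b j ∈ A j) → ∑ j, a j = ∑ j, b j → a = b) → (Set.extremePoints ℝ (convexHull ℝ ((fun e : Fin 2 →₀ ℕ => fun i : Fin 2 => ((e i : ℕ) : ℝ)) '' ((∑ i, ∏ j, f i j).support : Set (Fin 2 →₀ ℕ))))).ncard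 ≤ (m * t + 2) ^ C

/-- item stmt-ValiantsHypothesis-19542 · support · rank 4 · closed · refuted by Summit.ValiantsHypothesis.ValiantsHypothesis.Theorems.NewtonUnitEquationsNewtonTauWeak.not_hbigDesigns @ 6dc8d4642fac (prover) · by planner
[crux] REFUTATION-FIRST item (coordinator 18:1xZ, connectome v0): BIG SIGN DESIGNS EXIST — for every
exponent b some c-core sign design h : Fin c → Finset (Fin x) → ℕ² has MORE than
(2^(x+c)·(c·2^x)+2)^b strictly positively exposed configuration points q = Σ_d h d (f⁻¹ d) (strict
minimisers among all design points of some w₀x₀+w₁x₁, w₀,w₁>0). This is VERBATIM the hypothesis hbig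
of the landed theorem not_T2_of_designs
(Theorems/NewtonUnitEquationsNewtonTauWeakCoreKillCriterion.lean): HBigDesigns → ¬
stub_binomialNewtonTauCommon (T2 = KPTT Conj. 1 at t = 2, the one open stub of line
binomial-normal-form of crux NewtonTauWeak); pure additive combinatorics / discrete geometry
(exposed points of sumsets of set families along colourings), equivalently: the per-element base
f(c) = lim A(c,x)^(1/x) of c-core designs is unbounded in c. Finite family: HBigDesigns ↔ ∀ b ∃ c x,
HBigDesignsAt b c x (Cruxes/NewtonTauWeak/HBigThreeBin.lean). WHY IT MIGHT FAIL: kernel-checked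
coreChart_logBound gives f(c) ≤ 1+⌈log₂ c⌉, so a witness needs c ≥ 2^(4^b) cores and a
NON-hierarchical design; f(2)=2, f(3)=f(4)=3 exactly and every climb/anneal so far stays at base 3
(lead c7 three-bin law, card §9.3) — i -/
@[route_item "route-ValiantsHypothesis-NewtonUnitEquations"]
def HBigDesigns : Prop :=
  ∀ b : ℕ, ∃ (c x : ℕ) (h : Fin c → Finset (Fin x) → (Fin 2 →₀ ℕ)), (2 ^ (x + c) * (c * 2 ^ x) + 2) ^ b < {q : Fin 2 →₀ ℕ | (∃ f : Fin x → Fin c, ∑ d, h d (Finset.univ.filter fun u => f u = d) = q ∧ ∃ w : Fin 2 → ℝ, 0 < w 0 ∧ 0 < w 1 ∧ ∀ f' : Fin x → Fin c, ∑ d, h d (Finset.univ.filter fun u => f' u = d) ≠ q → w 0 * ((q 0 : ℕ) : ℝ) + w 1 * ((q 1 : ℕ) : ℝ) < w 0 * (((∑ d, h d (Finset.univ.filter fun u => f' u = d)) 0 : ℕ) : ℝ) + w 1 * (((∑ d, h d (Finset.univ.filter fun u => f' u = d)) 1 : ℕ) : ℝ))}.ncard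

/-- item stmt-ValiantsHypothesis-19605 · support · rank 5 · closed · moot by None · by planner
[crux] THREE-BIN LAW (lead c7, card Cruxes/NewtonTauWeak/Lines/binomial-normal-form-c7.md §9.3,
verbatim: "CONJECTURE (three-bin law): A(c,x) ≤ C_c·3^x for every c (true for c ≤ 4; C_4 ∈ [1,2])";
partner of the refutation-first item HBigDesigns): for every number of cores c there is a constant C
such that every c-core sign design h : Fin c → Finset (Fin x) → ℕ² on x attached elements has at
most C·3^x strictly positively exposed configuration points Σ_d h d (f⁻¹ d). Known: A(2,x) = 2^x,
A(3,x) = 3^x exactly (parabola design), c = 4: ≤ 2·3^x kernel-checked (fourCoreExposed_le), general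
c: ≤ 2^(k−1)(k+1)^x for c ≤ 2^k (coreChart_logBound). EXACT RELATION to HBigDesigns
(Cruxes/NewtonTauWeak/HBigThreeBin.lean): the per-c law alone does not decide HBigDesigns (constants
C_c free); with log C_c = O(c·b) — in particular the uniform hierarchical-cap shape (c+2)^a·3^x of
§9.3 — it gives ¬HBigDesigns, i.e. T2 is consistent on every sign design and the design kill switch
cannot fire; conversely HBigDesigns needs the per-element base sup_c lim_x A(c,x)^(1/x) = ∞, so
ThreeBinLaw-with-any-constants already confines witnesses to super-exponential C_c. WHY IT MIGHT
FAIL: a non-hierarchical design -/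
@[route_item "route-ValiantsHypothesis-NewtonUnitEquations"]
def ThreeBinLaw : Prop :=
  ∀ c : ℕ, ∃ C : ℕ, ∀ (x : ℕ) (h : Fin c → Finset (Fin x) → (Fin 2 →₀ ℕ)), {q : Fin 2 →₀ ℕ | (∃ f : Fin x → Fin c, ∑ d, h d (Finset.univ.filter fun u => f u = d) = q ∧ ∃ w : Fin 2 → ℝ, 0 < w 0 ∧ 0 < w 1 ∧ ∀ f' : Fin x → Fin c, ∑ d, h d (Finset.univ.filter fun u => f' u = d) ≠ q → w 0 * ((q 0 : ℕ) : ℝ) + w 1 * ((q 1 : ℕ) : ℝ) < w 0 * (((∑ d, h d (Finset.univ.filter fun u => f' u = d)) 0 : ℕ) : ℝ) + w 1 * (((∑ d, h d (Finset.univ.filter fun u => f' u = d)) 1 : ℕ) : ℝ))}.ncard ≤ C * 3 ^ x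

/-- item stmt-ValiantsHypothesis-16048 · support · rank 9 · closed · moot by None · by planner
[support] R1, the LOG-FACTOR (= many-products) regime of NewtonTauWeak: for sums of k products of at
most m ≤ ⌊log₂ k⌋ t-sparse bivariate polynomials the Newton polygon has ≤ (kt+2)^b vertices — a
POLYNOMIAL bound in kt with no budget for m (there 2^{am} ≤ k^a is swallowed). EXACT half of the
crux: NewtonTauWeak ↔ LogFactorBound ∧ FewProductsBound (RegimeSplit.lean, crux evidence:
newtonTauWeak_iff_subs, sorry-free). This is the ONLY regime the deciding theorem visits: in KPTT's
transfer (Thm 1 §3; tree theorem1_holds) m = O(√n) < log₂ k = Θ(√n log n) after padding k with zero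
products, so `closes` can be re-glued to LogFactorBound + a transfer item KpttTransferLog :
LogFactorBound → ¬IsVPFamily per (same proof as theorem1_holds with k padded to ≥ 2^m). Its content
is k-UNIFORMITY at k ≥ 2^m (the judge's key risk); the dissociated case is known only
quasi-polynomially ((t+2)(8(k+2)^3)^{⌈log₂ m⌉}, tree dissociated_quasiPoly), fixed-K rungs never
reach it. CANDIDATE SUB-CRUX of the regime split NewtonTauWeak ↔ LogFactorBound ∧ FewProductsBound
(crux-strategist cstrat-5904, 2026-08-16; `route edit --split` is reserved to the lead's final
cycle, so both halves are filed as support item -/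
@[route_item "route-ValiantsHypothesis-NewtonUnitEquations"]
def LogFactorBound : Prop :=
  ∃ b : ℕ, ∀ (k m t : ℕ) (f : Fin k → Fin m → MvPolynomial (Fin 2) ℂ), m ≤ Nat.log 2 k → (∀ i j, (f i j).support.card ≤ t) → (Set.extremePoints ℝ (convexHull ℝ ((fun e : Fin 2 →₀ ℕ => fun i : Fin 2 => ((e i : ℕ) : ℝ)) '' ((∑ i, ∏ j, f i j).support : Set (Fin 2 →₀ ℕ))))).ncard ≤ (k * t + 2) ^ b

/-- item stmt-ValiantsHypothesis-16052 · support · rank 9 · closed · moot by None · by planner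
[support] R2, the FEW-PRODUCTS regime of NewtonTauWeak: for k ≤ 2^m products of m t-sparse bivariate
polynomials the Newton polygon has ≤ 2^{am}(t+2)^b vertices — here uniformity in k is FREE (k ≤ 2^m
is paid by the 2^{O(m)} budget) and the whole difficulty is the t-dependence under coincidences.
EXACT other half of the crux (NewtonTauWeak ↔ LogFactorBound ∧ FewProductsBound, RegimeSplit.lean).
Filed as SUPPORT on purpose: the deciding theorem never needs it (closes can be re-glued to
LogFactorBound alone), so it should not draw provers; it is the natural REFUTATION surface of the
typed crux — a dissociated design with k = 2^{m/2} products and k^{Ω(log m)} vertices (the growth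
the landed dissociated_quasiPoly bound still permits) would refute FewProductsBound and
NewtonTauWeak as typed WITHOUT touching the summit transfer (which tolerates 2^{(m+log kt)^c}, c <
2: KPTT Thm 1 as printed). All fixed-K / t = 2 rungs of the crux's lines (K ≤ 2 p97933, K = 3
hexagon, DissociatedFixedK) are instances of this regime. CANDIDATE SUB-CRUX of the regime split
NewtonTauWeak ↔ LogFactorBound ∧ FewProductsBound (crux-strategist cstrat-5904, 2026-08-16; `route
edit --split` is reserved to the lead -/
@[route_item "route-ValiantsHypothesis-NewtonUnitEquations"]
def FewProductsBound : Prop :=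
  ∃ a b : ℕ, ∀ (k m t : ℕ) (f : Fin k → Fin m → MvPolynomial (Fin 2) ℂ), k ≤ 2 ^ m → (∀ i j, (f i j).support.card ≤ t) → (Set.extremePoints ℝ (convexHull ℝ ((fun e : Fin 2 →₀ ℕ => fun i : Fin 2 => ((e i : ℕ) : ℝ)) '' ((∑ i, ∏ j, f i j).support : Set (Fin 2 →₀ ℕ))))).ncard ≤ 2 ^ (a * m) * (t + 2) ^ b

/-- item stmt-ValiantsHypothesis-16113 · support · rank 9 · closed · proved by Summit.ValiantsHypothesis.ValiantsHypothesis.Theorems.kpttTransferLog_proof (prover) · by planner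
[support] KPTT Thm 1 re-run on the LOG-FACTOR regime: LogFactorBound (route item
stmt-ValiantsHypothesis-16048, inlined) → the permanent family is not a VP family over ℂ. PROVED by
the crux-strategist in Cruxes/NewtonTauWeak/RetargetTransfer.lean (`KPTT.kpttTransferLog_holds`,
sorry-free, axioms propext/choice/Quot.sound): same proof as the tree's KPTT.theorem1_holds with the
sum-of-products form padded by 2^m zero products so that m ≤ log₂ k (`sum_prod_append_zero`,
`vert_le_of_logFactorBound`), m = 0 handled (the witness would be constant), final inequality
exists_pow_sqrt_lt_two_pow ((2C+3)b+1). A prover lands the file verbatim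
(Literature/Computability/AlgebraicComplexity/NewtonPolygonTauTransferLog.lean or Theorems/).
PURPOSE: with this item `closes` can be re-glued to (LogFactorBound, KpttTransferLog) — `closes_log`
in Cruxes/NewtonTauWeak/AdmissibleRetarget.lean is that deciding theorem and elaborates — making the
summit-relevant half R1 of the regime split the route's target and leaving FewProductsBound (R2,
summit-irrelevant) as a pure refutation surface; see Cruxes/NewtonTauWeak/STRATEGY-CENSUS.md
§Strengthen S-D. Nothing is cut: NewtonTauWeak stays a (stronger) target. s -/
@[route_item "route-ValiantsHypothesis-NewtonUnitEquations"]
def KpttTransferLog : Prop :=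
  (∃ b : ℕ, ∀ (k m t : ℕ) (f : Fin k → Fin m → MvPolynomial (Fin 2) ℂ), m ≤ Nat.log 2 k → (∀ i j, (f i j).support.card ≤ t) → (Set.extremePoints ℝ (convexHull ℝ ((fun e : Fin 2 →₀ ℕ => fun i : Fin 2 => ((e i : ℕ) : ℝ)) '' ((∑ i, ∏ j, f i j).support : Set (Fin 2 →₀ ℕ))))).ncard ≤ (k * t + 2) ^ b) → ¬ Literature.Computability.AlgebraicComplexity.IsVPFamily (fun n => Literature.Computability.AlgebraicComplexity.perPoly (Fin n) ℂ)

/-- item stmt-ValiantsHypothesis-18548 · support · rank 9 · closed · proved by Summit.ValiantsHypothesis.ValiantsHypothesis.Theorems.kpttTransferRoot_proof @ d8257fd2d5b8 (prover) · by planner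
[support, transfer] KPTT Thm 1 (arXiv:1308.2286) re-run on the ROOT form: NewtonTauRoot → the
permanent family is not a VP family over ℂ. PROVED sorry-free in the crux workfile
lean/Summits/ValiantsHypothesis/ValiantsHypothesis/Cruxes/NewtonTauWeak/StrategistGen2Retarget.lean
as Literature.Computability.AlgebraicComplexity.KPTT.kpttTransferRoot_holds (via
not_isVPFamily_per_of_admissible = the tree's theorem1_holds with the final computation replaced by
a growth hypothesis, and the growth lemma exists_rootBound_lt_two_pow at n = 16^j); a prover lands
it verbatim under Theorems/ (as was done for KpttTransferLog). -/
@[route_item "route-ValiantsHypothesis-NewtonUnitEquations", crux]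
def KpttTransferRoot : Prop :=
  (∃ a b : ℕ, ∀ (k m t : ℕ) (f : Fin k → Fin m → MvPolynomial (Fin 2) ℂ), (∀ i j, (f i j).support.card ≤ t) → (Set.extremePoints ℝ (convexHull ℝ ((fun e : Fin 2 →₀ ℕ => fun i : Fin 2 => ((e i : ℕ) : ℝ)) '' ((∑ i, ∏ j, f i j).support : Set (Fin 2 →₀ ℕ))))).ncard ≤ 2 ^ (a * m) * (k * t + 2) ^ (b * (Nat.sqrt m + 1))) → ¬ Literature.Computability.AlgebraicComplexity.IsVPFamily (fun n => Literature.Computability.AlgebraicComplexity.perPoly (Fin n) ℂ)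

/-- item stmt-ValiantsHypothesis-5908 · support · rank 9 · closed · proved by Summit.ValiantsHypothesis.Theorems.binomialPencil_proof (prover) · by planner
sources: arXiv:1308.2286, Fischer1975
[support] the card's proved (2,2) rung: for binomials with common exponents d_j having distinct
subset sums and nonzero α_j, β_j, Newt(Π_j(1+α_j X^(d_j)) − c·Π_j(1+β_j X^(d_j))) has ≤ C(m+1)²
vertices. Proof: if no α_j = β_j the cancellation set {S : Π_(j∈S) β_j/α_j = 1/c} is an independent
set of the cube Q_m, so every hull vertex is d_(S_w) or d_(S_w △ j*(w)) (S_w = {j : ⟨w,d_j⟩ > 0}, j*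
= argmin|⟨w,d_j⟩|), O(m) + O(m²) values as w rotates; a common factor 1+αX^d is a Minkowski summand
(segment, +2 vertices), induct on m. [difficulty: provable-now] -/
@[route_item "route-ValiantsHypothesis-NewtonUnitEquations"]
def BinomialPencil : Prop :=
  ∃ C : ℕ, ∀ (m : ℕ) (d : Fin m → (Fin 2 →₀ ℕ)) (α β : Fin m → ℂ) (c : ℂ), (∀ S T : Finset (Fin m), ∑ j ∈ S, d j = ∑ j ∈ T, d j → S = T) → (∀ j, α j ≠ 0) → (∀ j, β j ≠ 0) → (Set.extremePoints ℝ (convexHull ℝ ((fun e : Fin 2 →₀ ℕ => fun i : Fin 2 => ((e i : ℕ) : ℝ)) '' ((∏ j, (1 + MvPolynomial.C (α j) * MvPolynomial.monomial (d j) 1) - MvPolynomial.C c * ∏ j, (1 + MvPolynomial.C (β j) * MvPolynomial.monomial (d j) 1)).support : Set (Fin 2 →₀ ℕ))))).ncard ≤ C * (m + 1) ^ 2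

/-- item stmt-ValiantsHypothesis-5909 · support · rank 9 · closed · proved by Summit.ValiantsHypothesis.ValiantsHypothesis.Theorems.kpttTransfer_proof @ 6606d10c17aa (prover) · by planner
sources: arXiv:1308.2286, KoiranPortierTavenasThomasse2015, Tavenas2014, Koiran2011
[support] KPTT Thm 1 (theorem in print; X inlined): the weak Newton-polygon τ-conjecture implies
that (per_n) is not a VP family over ℂ (constants unrestricted). Proof to formalise = KPTT §3 with
the tree's machinery: witness W_n(X,Y) = Σ_(i<2^n) X^i Y^(2i(2^n−1−i)) = aeval(x_j ↦ X^(2^j), z_l ↦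
Y^(2^l)) (TavenasVn.hV ℂ n) — 2^n points on a strictly concave parabola, all vertices; hV is a
projection of PER_q(n) (TavenasVn.isProjection_boolSum_eval with BCS1997_thm_21_27/29_holds ℂ);
under IsVPFamily per, complexity(hV) = n^O(1), and the proved depth-four reduction
(DepthReduction.SLP.exists_sum_prod, as in exists_sps_of_isProjection_perPoly but over ℂ with
`complexity`) writes W_n as Σ^k Π^m of t-sparse polynomials with k, t ≤ (n+2)^(C√n), m ≤ C√n; then
2^(aC√n)((n+2)^(2C√n)+2)^b < 2^n for large n (cf. exists_pow_sqrt_lt_two_pow). [difficulty: M] -/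
@[route_item "route-ValiantsHypothesis-NewtonUnitEquations"]
def KpttTransfer : Prop :=
  (∃ a b : ℕ, ∀ (k m t : ℕ) (f : Fin k → Fin m → MvPolynomial (Fin 2) ℂ), (∀ i j, (f i j).support.card ≤ t) → (Set.extremePoints ℝ (convexHull ℝ ((fun e : Fin 2 →₀ ℕ => fun i : Fin 2 => ((e i : ℕ) : ℝ)) '' ((∑ i, ∏ j, f i j).support : Set (Fin 2 →₀ ℕ))))).ncard ≤ 2 ^ (a * m) * (k * t + 2) ^ b) → ¬ Literature.Computability.AlgebraicComplexity.IsVPFamily (fun n => Literature.Computability.AlgebraicComplexity.perPoly (Fin n) ℂ)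

/-- item stmt-ValiantsHypothesis-5910 · assembly · rank 1 · closed · proved by Summit.ValiantsHypothesis.Theorems.NewtonUnitEquations.Assembly_proof (prover) · by planner
sources: arXiv:1308.2286, Valiant1979, Burgisser2000
[assembly] NewtonTauWeak → KpttTransfer → ValiantsHypothesis (hub + mem_VP_ofFintype_iff_holds +
perFamily_mem_VNP_holds). -/
@[route_item "route-ValiantsHypothesis-NewtonUnitEquations"]
def Assembly : Prop :=
  NewtonTauWeak → KpttTransfer → ValiantsHypothesis

/-! D-0027 §2.1 — DECIDING THEOREM (planner-authored via `route open/edit --closes-file`; by planner-rtask-ValiantsHypothesis-NewtonUnitE-7eececed-0 2026-08-17T16:42:52Z) — ARCHIVED: route closed (refuted) 2026-08-20T21:25:10Z; kept so importers keep building: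
its hypotheses are this route's items and its conclusion the sub-problem Statement (glue_lint), and it elaborates with this file. -/

/-- D-0027 §2.1 deciding theorem of route NewtonUnitEquations (retarget 2026-08-17, ranking §2.9 / strategist r1):
the weak Newton-polygon τ-conjecture in ROOT form (`NewtonTauRoot`: `#vert Newt(Σ_{i<k}Π_{j<m} f_ij) ≤
2^{am}(kt+2)^{b(⌊√m⌋+1)}` for `t`-sparse `f_ij`; KPTT arXiv:1308.2286 Conj. 1 weakened to the transfer threshold)
and KPTT Thm 1 re-run on that form (`KpttTransferRoot`: it forces `per ∉ VP_ℂ` as an `IsVPFamily` statement;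
proved sorry-free in `Cruxes/NewtonTauWeak/StrategistGen2Retarget.lean`) give `VP_ℂ ≠ VNP_ℂ`:
if `VP ℂ = VNP ℂ` then Valiant's theorem `perFamily ℂ ∈ VNP ℂ`
(`Literature.Computability.AlgebraicComplexity.perFamily_mem_VNP_holds`) puts the bundled permanent
family in `VP ℂ`, the renaming bridge `mem_VP_ofFintype_iff_holds` turns that into
`IsVPFamily (fun n => perPoly (Fin n) ℂ)`, contradicting `KpttTransferRoot NewtonTauRoot`.
The sharp form `NewtonTauWeak` (kernel chain commonStep → binomialStep → fischerStep) implies `NewtonTauRoot`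
with the same constants and stays in the route as its strongest sufficient form. -/
@[closes "route-ValiantsHypothesis-NewtonUnitEquations"] theorem closes (h_NewtonTauRoot : NewtonTauRoot) (h_KpttTransferRoot : KpttTransferRoot) :
    _root_.ValiantsHypothesis := by
  show Literature.Computability.AlgebraicComplexity.VP ℂ ≠
    Literature.Computability.AlgebraicComplexity.VNP ℂ
  intro hEq
  have hVNP := Literature.Computability.AlgebraicComplexity.perFamily_mem_VNP_holds ℂ
  have hVP : Literature.Computability.AlgebraicComplexity.perFamily ℂ ∈
      Literature.Computability.AlgebraicComplexity.VP ℂ := by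
    rw [hEq]; exact hVNP
  exact h_KpttTransferRoot h_NewtonTauRoot
    ((Literature.Computability.AlgebraicComplexity.mem_VP_ofFintype_iff_holds _).1 hVP)

end Summit.ValiantsHypothesis.ValiantsHypothesis.Theses.NewtonUnitEquations
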